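import Summits.AtomisticToContinuum.BoseEinsteinCondensation.Theorems.BECGroundStateSOSPeriodicIRBoundDefs
import Summits.AtomisticToContinuum.BoseEinsteinCondensation.Theorems.BECGroundStateSOSPeriodicIRBoundWFDefs
import Literature.MathematicalPhysics.QuantumManyBody.TorusFockLayer
import Literature.MathematicalPhysics.QuantumManyBody.PeriodicBoseGasRelabelling
import Literature.MathematicalPhysics.QuantumManyBody.PeriodicFormDomain
import Mathlib.Algebra.Order.Chebyshev
import HarnessLib

/-! # Crux `PeriodicIRBound` (stmt-AtomisticToContinuum-3972), line `linear-ph-floor-wagner`, stub 5b `stub_wagnerFeynman` — FormBounds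
Crude a priori bounds, part 1: the potential halves `P[a_kΦ] ≤ (m+1)P[Φ]`, `P[a_k†Φ] ≤ …`, finiteness (P-d). -/

/-!
# Form-boundedness of `a(φ)` and `a†(φ)`, part 1: the potential halves and finiteness

`WFFormBounds2.lean`, adds the kinetic halves and assembles B8 `qform_modeAn_le` and
B9 `qform_modeCr_le`). For the normalised plane wave `φ = planeWaveMode L k` (`|φ|² = L⁻³`), the
annihilation `aΦ = modeAn L φ Φ` and the creation `a†Φ = modeCr φ Φ` are bounded in the potential
form `P_w[g] = ∫_{cell} W|g|²`, `W = ∑_{i<j} w^per(xᵢ - xⱼ)`: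

* `potForm_modeAn_le` : `P[aΦ] ≤ (m+1) P[Φ]` for a continuous `(m+1)`-body `Φ` (Bessel's inequality
  in the contracted particle, `nnnorm_sq_integral_conj_planeWaveMode_mul_le`, and
  `W_m(Y) ≤ W_{m+1}(x, Y)`);
* `potForm_modeCr_le` : `P[a†Φ] ≤ (n+1)(P[Φ] + L⁻³ n‖w‖₁ ‖Φ‖²)` for a continuous `n`-body `Φ`
  (Cauchy–Schwarz on the `n+1` terms of `a†`, `nnnorm_modeCr_sq_le`; relabelling symmetry of the
  cell integral, `lintegral_cellN_symm_mul_removeNth`; `∫_cell W_{n+1}(x, Y) dx = L³ W_n(Y) + n‖w‖₁`,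
  `lintegral_cell_periodicInteraction_vecCons_eq`);
* `potForm_modeAn_ne_top_and` (P-d) : `P[aΦ], P[a†Φ] < ∞` when `P[Φ] < ∞` and `‖w‖₁ < ∞`.
-/

noncomputable section

open scoped BigOperators ENNReal ComplexConjugate
open Filter MeasureTheory

namespace Summit.AtomisticToContinuum.BoseEinsteinCondensation.Cruxes.PeriodicIRBound.LinearPhFloorWagner.WF

open Literature.MathematicalPhysics.QuantumManyBody.BoseGas

variable {M m n : ℕ} {L : ℝ}

/-! ## Measurability and two elementary inequalities -/

/-- The periodised potential of a measurable profile is measurable. [folklore] -/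
private theorem measurable_periodizedPotential_fb {w : ℝ → ℝ≥0∞} (hw : Measurable w) (L : ℝ) :
    Measurable (periodizedPotential w L) := by
  show Measurable fun x => ∑' q : Fin 3 → ℤ, w ‖x - latticeVec L q‖
  exact Measurable.tsum fun q => hw.comp (measurable_id.sub_const _).norm

/-- The periodic interaction of a measurable profile is measurable. [folklore] -/
private theorem measurable_periodicInteraction_fb {w : ℝ → ℝ≥0∞} (hw : Measurable w) (L : ℝ) :
    Measurable fun X : Config M => periodicInteraction w L X := by
  unfold periodicInteraction
  refine Finset.measurable_sum _ fun i _ => Finset.measurable_sum _ fun j _ => ?_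
  exact (measurable_periodizedPotential_fb hw L).comp
    ((measurable_pi_apply i).sub (measurable_pi_apply j))

/-- The kinetic density of any function is measurable (`fderiv` is measurable). [folklore] -/
theorem measurable_kineticDensity_fb (f : Config M → ℂ) : Measurable (kineticDensity f) := by
  refine Finset.measurable_sum _ fun i _ => Finset.measurable_sum _ fun c _ => ?_
  exact ((measurable_fderiv_apply_const ℝ f _).nnnorm.coe_nnreal_ennreal).pow_const 2

/-- `𝓔[f] = ∫|∇f|² + P[f]`. [folklore] -/
theorem qform_eq_lintegral_kineticDensity_add_potForm (w : ℝ → ℝ≥0∞) (L : ℝ) (f : Config M → ℂ) :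
    qform w L f = (∫⁻ X in cellN M L, kineticDensity f X) + potForm w L f :=
  lintegral_add_left (measurable_kineticDensity_fb f) _

/-- **Cauchy–Schwarz on a finite sum**, `ℝ≥0∞` form: `‖∑_{j∈s} a_j‖₊² ≤ #s · ∑_{j∈s} ‖a_j‖₊²`.
[folklore] -/
theorem nnnorm_sum_sq_le {ι : Type*} (s : Finset ι) (a : ι → ℂ) :
    ((‖∑ j ∈ s, a j‖₊ : ℝ≥0∞)) ^ 2 ≤ (s.card : ℝ≥0∞) * ∑ j ∈ s, ((‖a j‖₊ : ℝ≥0∞)) ^ 2 := by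
  have h : ‖∑ j ∈ s, a j‖ ^ 2 ≤ s.card * ∑ j ∈ s, ‖a j‖ ^ 2 :=
    (pow_le_pow_left₀ (norm_nonneg _) (norm_sum_le s a) 2).trans sq_sum_le_card_mul_sum_sq
  simp only [coe_nnnorm_sq_eq_ofReal]
  rw [← ENNReal.ofReal_natCast, ← ENNReal.ofReal_sum_of_nonneg fun _ _ => by positivity,
    ← ENNReal.ofReal_mul (Nat.cast_nonneg _)]
  exact ENNReal.ofReal_le_ofReal h

/-- Undoing the prefactor of `a†`: `(n+1) ‖(√(n+1))⁻¹ z‖₊² = ‖z‖₊²`. [folklore] -/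
theorem cast_succ_mul_nnnorm_inv_sqrt_mul_sq (n : ℕ) (z : ℂ) :
    (n + 1 : ℝ≥0∞) * ((‖((Real.sqrt (n + 1) : ℝ) : ℂ)⁻¹ * z‖₊ : ℝ≥0∞)) ^ 2 =
      ((‖z‖₊ : ℝ≥0∞)) ^ 2 := by
  rw [← nnnorm_sqrt_mul_sq, ← mul_assoc, mul_inv_cancel₀ (sqrt_cast_ne_zero n), one_mul]

/-- `|φ_k(x)|² = L⁻³` in `ℝ≥0∞`. [folklore] -/
theorem coe_nnnorm_planeWaveMode_sq (hL : 0 < L) (k : Fin 3 → ℤ) (x : Space) :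
    ((‖planeWaveMode L k x‖₊ : ℝ≥0∞)) ^ 2 = (ENNReal.ofReal L ^ 3)⁻¹ := by
  rw [coe_nnnorm_sq_eq_ofReal, norm_planeWaveMode, inv_pow, Real.sq_sqrt (by positivity),
    ENNReal.ofReal_inv_of_pos (by positivity), ENNReal.ofReal_pow hL.le]

/-- **Bessel's inequality for one plane wave**: `‖∫_cell conj(φ_p) f‖₊² ≤ ∫_cell ‖f‖₊²` for a
continuous `f` (`|∫ conj φ_p f|² = L³|ĉ_p(f)|²` and Parseval `∑_q |ĉ_q(f)|² = L⁻³ ∫_cell |f|²`).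
[folklore] -/
theorem nnnorm_sq_integral_conj_planeWaveMode_mul_le (hL : 0 < L) (p : Fin 3 → ℤ)
    {f : Space → ℂ} (hf : Continuous f) :
    ((‖∫ x in cell L, conj (planeWaveMode L p x) * f x‖₊ : ℝ≥0∞)) ^ 2 ≤
      ∫⁻ x in cell L, ((‖f x‖₊ : ℝ≥0∞)) ^ 2 := by
  have hL3 : ENNReal.ofReal L ^ 3 ≠ 0 := pow_ne_zero _ (ENNReal.ofReal_pos.2 hL).ne'
  have hL3' : ENNReal.ofReal L ^ 3 ≠ ⊤ := ENNReal.pow_ne_top ENNReal.ofReal_ne_top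
  rw [nnnorm_sq_integral_conj_planeWaveMode_mul hL p f]
  calc ENNReal.ofReal L ^ 3 * ((‖cellFourierCoeff L f p‖₊ : ℝ≥0∞)) ^ 2
      ≤ ENNReal.ofReal L ^ 3 * ∑' q, ((‖cellFourierCoeff L f q‖₊ : ℝ≥0∞)) ^ 2 :=
        mul_le_mul_right (ENNReal.le_tsum p) _
    _ = ∫⁻ x in cell L, ((‖f x‖₊ : ℝ≥0∞)) ^ 2 := by
        rw [tsum_sq_cellFourierCoeff hL hf, ← mul_assoc, ENNReal.mul_inv_cancel hL3 hL3', one_mul]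

/-! ## The potential half of B8: `P[aΦ] ≤ (m+1) P[Φ]` -/

/-- Pointwise bound on `aΦ`: `‖(aΦ)(Y)‖₊² ≤ (m+1) ∫_cell ‖Φ(x, Y)‖₊² dx`. [folklore] -/
theorem nnnorm_modeAn_sq_le (hL : 0 < L) (k : Fin 3 → ℤ) {Φ : Config (m + 1) → ℂ}
    (hΦ : Continuous Φ) (Y : Config m) :
    ((‖modeAn L (planeWaveMode L k) Φ Y‖₊ : ℝ≥0∞)) ^ 2 ≤
      (m + 1 : ℝ≥0∞) * ∫⁻ x in cell L, ((‖Φ (Matrix.vecCons x Y)‖₊ : ℝ≥0∞)) ^ 2 := by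
  rw [modeAn_apply, nnnorm_sqrt_mul_sq]
  exact mul_le_mul_right (nnnorm_sq_integral_conj_planeWaveMode_mul_le hL k
    (hΦ.comp (continuous_id.matrixVecCons continuous_const))) _

/-- `W_{m+1}(x, Y) = W_m(Y) + ∑_b w^per(x - y_b)` (the tree's `periodicInteraction_succ`). [folklore] -/
private theorem periodicInteraction_vecCons_fb (w : ℝ → ℝ≥0∞) (L : ℝ) (x : Space) (Y : Config m) :
    periodicInteraction w L (Matrix.vecCons x Y) =
      periodicInteraction w L Y + ∑ b : Fin m, periodizedPotential w L (x - Y b) := by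
  rw [periodicInteraction_succ, add_comm]
  simp only [Matrix.cons_val_zero, Matrix.cons_val_succ, Matrix.tail_cons]

/-- **Potential half of B8**: `P[aΦ] ≤ (m+1) P[Φ]` for a continuous `(m+1)`-body `Φ`
(`‖aΦ(Y)‖² ≤ (m+1)∫_x|Φ(x,Y)|²` and `W_m(Y) ≤ W_{m+1}(x, Y)`). [folklore] -/
theorem potForm_modeAn_le (hL : 0 < L) {w : ℝ → ℝ≥0∞} (hw : Measurable w) (k : Fin 3 → ℤ)
    {Φ : Config (m + 1) → ℂ} (hΦ : Continuous Φ) :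
    potForm w L (modeAn L (planeWaveMode L k) Φ) ≤ (m + 1 : ℝ≥0∞) * potForm w L Φ := by
  have hsl : ∀ Y : Config m, Measurable fun x : Space =>
      ((‖Φ (Matrix.vecCons x Y)‖₊ : ℝ≥0∞)) ^ 2 := fun Y =>
    ((hΦ.comp (continuous_id.matrixVecCons continuous_const)).measurable.nnnorm.coe_nnreal_ennreal).pow_const _
  have hF : Measurable fun X : Config (m + 1) =>
      periodicInteraction w L X * ((‖Φ X‖₊ : ℝ≥0∞)) ^ 2 :=
    (measurable_periodicInteraction_fb hw L).mul
      ((hΦ.measurable.nnnorm.coe_nnreal_ennreal).pow_const _)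
  unfold potForm
  rw [lintegral_cellN_succ L hF, ← lintegral_const_mul' _ _ (by simp)]
  refine lintegral_mono fun Y => ?_
  calc periodicInteraction w L Y * ((‖modeAn L (planeWaveMode L k) Φ Y‖₊ : ℝ≥0∞)) ^ 2
      ≤ periodicInteraction w L Y *
          ((m + 1 : ℝ≥0∞) * ∫⁻ x in cell L, ((‖Φ (Matrix.vecCons x Y)‖₊ : ℝ≥0∞)) ^ 2) :=
        mul_le_mul_right (nnnorm_modeAn_sq_le hL k hΦ Y) _
    _ = (m + 1 : ℝ≥0∞) * ∫⁻ x in cell L,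
          periodicInteraction w L Y * ((‖Φ (Matrix.vecCons x Y)‖₊ : ℝ≥0∞)) ^ 2 := by
        rw [lintegral_const_mul _ (hsl Y), mul_left_comm]
    _ ≤ (m + 1 : ℝ≥0∞) * ∫⁻ x in cell L, periodicInteraction w L (Matrix.vecCons x Y) *
          ((‖Φ (Matrix.vecCons x Y)‖₊ : ℝ≥0∞)) ^ 2 := by
        refine mul_le_mul_right (lintegral_mono fun x => mul_le_mul_left ?_ _) _
        rw [periodicInteraction_vecCons_fb]
        exact le_self_add

/-! ## The potential half of B9: `P[a†Φ] ≤ (n+1)(P[Φ] + n‖w‖₁/L³ ‖Φ‖²)` -/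

/-- Pointwise bound on `a†Φ` (Cauchy–Schwarz on the `n+1` terms, `|φ|² = L⁻³`):
`‖(a†Φ)(X)‖₊² ≤ L⁻³ ∑_j ‖Φ(X̂_j)‖₊²`. [folklore] -/
theorem nnnorm_modeCr_sq_le (hL : 0 < L) (k : Fin 3 → ℤ) (Φ : Config n → ℂ) (X : Config (n + 1)) :
    ((‖modeCr (planeWaveMode L k) Φ X‖₊ : ℝ≥0∞)) ^ 2 ≤
      (ENNReal.ofReal L ^ 3)⁻¹ * ∑ j : Fin (n + 1), ((‖Φ (j.removeNth X)‖₊ : ℝ≥0∞)) ^ 2 := by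
  have h0 : (n + 1 : ℝ≥0∞) ≠ 0 := by simp
  rw [← ENNReal.mul_le_mul_iff_right h0 (by simp), modeCr_apply,
    cast_succ_mul_nnnorm_inv_sqrt_mul_sq]
  calc ((‖∑ j : Fin (n + 1), planeWaveMode L k (X j) * Φ (j.removeNth X)‖₊ : ℝ≥0∞)) ^ 2
      ≤ ((Finset.univ : Finset (Fin (n + 1))).card : ℝ≥0∞) * ∑ j : Fin (n + 1),
          ((‖planeWaveMode L k (X j) * Φ (j.removeNth X)‖₊ : ℝ≥0∞)) ^ 2 := nnnorm_sum_sq_le _ _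
    _ = (n + 1 : ℝ≥0∞) * ((ENNReal.ofReal L ^ 3)⁻¹ *
          ∑ j : Fin (n + 1), ((‖Φ (j.removeNth X)‖₊ : ℝ≥0∞)) ^ 2) := by
        rw [Finset.card_univ, Fintype.card_fin]
        push_cast
        congr 1
        rw [Finset.mul_sum]
        refine Finset.sum_congr rfl fun j _ => ?_
        rw [nnnorm_mul, ENNReal.coe_mul, mul_pow, coe_nnnorm_planeWaveMode_sq hL]

/-- Moving particle `j` to the front: `X ∘ (cycleRange j)⁻¹ = (x_j, X̂_j)`. [folklore] -/
theorem comp_cycleRange_symm_eq_vecCons (j : Fin (n + 1)) (X : Config (n + 1)) :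
    X ∘ j.cycleRange.symm = Matrix.vecCons (X j) (j.removeNth X) := by
  funext i
  have h := congrFun (vecCons_self_removeNth_comp_cycleRange j X) (j.cycleRange.symm i)
  simp only [Function.comp_apply, Equiv.apply_symm_apply] at h
  simpa only [Function.comp_apply] using h.symm

/-- **Relabelling and slicing**: for a Bose-symmetric measurable weight `S` on `(ℝ³)^{n+1}`,
`∫_{X} S(X) G(X̂_j) dX = ∫_Y (∫_x S(x, Y) dx) G(Y) dY` (relabel by `(cycleRange j)⁻¹`, which moves
particle `j` to the front and preserves the cell integral, then Tonelli). [folklore] -/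
theorem lintegral_cellN_symm_mul_removeNth {S : Config (n + 1) → ℝ≥0∞} (hS : Measurable S)
    (hsymm : ∀ (σ : Equiv.Perm (Fin (n + 1))) (X : Config (n + 1)), S (X ∘ σ) = S X)
    {G : Config n → ℝ≥0∞} (hG : Measurable G) (j : Fin (n + 1)) :
    ∫⁻ X in cellN (n + 1) L, S X * G (j.removeNth X) =
      ∫⁻ Y in cellN n L, (∫⁻ x in cell L, S (Matrix.vecCons x Y)) * G Y := by
  have hperm := lintegral_cellN_comp_perm (L := L) j.cycleRange.symm
    (fun X => S X * G (Fin.removeNth 0 X))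
  have hlhs : ∀ X : Config (n + 1), S (X ∘ j.cycleRange.symm) *
      G (Fin.removeNth 0 (X ∘ j.cycleRange.symm)) = S X * G (j.removeNth X) := fun X => by
    rw [hsymm, comp_cycleRange_symm_eq_vecCons, removeNth_zero_vecCons]
  simp only [hlhs] at hperm
  have hF : Measurable fun X : Config (n + 1) => S X * G (Fin.removeNth 0 X) :=
    hS.mul (hG.comp (continuous_removeNth 0).measurable)
  rw [hperm, lintegral_cellN_succ L hF]
  refine lintegral_congr fun Y => ?_
  simp only [removeNth_zero_vecCons]
  rw [lintegral_mul_const]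
  exact hS.comp (continuous_id.matrixVecCons continuous_const).measurable

/-- The case `S = 1`: `∫_X G(X̂_j) dX = L³ ∫_Y G`. [folklore] -/
theorem lintegral_cellN_comp_removeNth {G : Config n → ℝ≥0∞} (hG : Measurable G) (j : Fin (n + 1)) :
    ∫⁻ X in cellN (n + 1) L, G (j.removeNth X) = ENNReal.ofReal L ^ 3 * ∫⁻ Y in cellN n L, G Y := by
  have h := lintegral_cellN_symm_mul_removeNth (L := L) (S := fun _ => (1 : ℝ≥0∞)) measurable_const
    (fun _ _ => rfl) hG j
  simp only [one_mul] at h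
  rw [h, setLIntegral_const, one_mul, volume_cell,
    lintegral_const_mul' _ _ (ENNReal.pow_ne_top ENNReal.ofReal_ne_top)]

/-- **Integrating out the front particle of the weight**:
`∫_cell W_{n+1}(x, Y) dx = L³ W_n(Y) + n ‖w‖₁` (`∫_cell w^per(x - c) dx = ‖w‖₁`). [folklore] -/
theorem lintegral_cell_periodicInteraction_vecCons_eq (hL : 0 < L) {w : ℝ → ℝ≥0∞} (hw : Measurable w)
    (Y : Config n) :
    ∫⁻ x in cell L, periodicInteraction w L (Matrix.vecCons x Y) =
      ENNReal.ofReal L ^ 3 * periodicInteraction w L Y + n * ∫⁻ z : Space, w ‖z‖ := by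
  simp only [periodicInteraction_vecCons_fb]
  rw [lintegral_add_left measurable_const, setLIntegral_const, mul_comm, volume_cell,
    lintegral_finsetSum _ fun b _ =>
      show Measurable (fun x : Space => periodizedPotential w L (x - Y b)) from
        (measurable_periodizedPotential_fb hw L).comp (measurable_id.sub_const _)]
  simp only [lintegral_cell_periodizedPotential_sub hL hw, Finset.sum_const, Finset.card_univ,
    Fintype.card_fin, nsmul_eq_mul]

/-- **Potential half of B9**: `P[a†Φ] ≤ (n+1)(P[Φ] + L⁻³ · n‖w‖₁ · ‖Φ‖²)` for a continuous
`n`-body `Φ`. [folklore] -/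
theorem potForm_modeCr_le (hL : 0 < L) {w : ℝ → ℝ≥0∞} (hw : Measurable w) (k : Fin 3 → ℤ)
    {Φ : Config n → ℂ} (hΦ : Continuous Φ) :
    potForm w L (modeCr (planeWaveMode L k) Φ) ≤ (n + 1 : ℝ≥0∞) *
      (potForm w L Φ + (ENNReal.ofReal L ^ 3)⁻¹ * ((n : ℝ≥0∞) * ∫⁻ z : Space, w ‖z‖) * normSq L Φ) := by
  have hV : ENNReal.ofReal L ^ 3 ≠ 0 := pow_ne_zero _ (ENNReal.ofReal_pos.2 hL).ne'
  have hV' : ENNReal.ofReal L ^ 3 ≠ ⊤ := ENNReal.pow_ne_top ENNReal.ofReal_ne_top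
  have hW : Measurable fun X : Config (n + 1) => periodicInteraction w L X :=
    measurable_periodicInteraction_fb hw L
  have hWn : Measurable fun Y : Config n => periodicInteraction w L Y :=
    measurable_periodicInteraction_fb hw L
  have hΦ2 : Measurable fun Y : Config n => ((‖Φ Y‖₊ : ℝ≥0∞)) ^ 2 :=
    (hΦ.measurable.nnnorm.coe_nnreal_ennreal).pow_const _
  have hsymm : ∀ (σ : Equiv.Perm (Fin (n + 1))) (X : Config (n + 1)),
      periodicInteraction w L (X ∘ σ) = periodicInteraction w L X :=
    fun σ X => periodicInteraction_comp_perm w L σ X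
  -- each of the `n+1` terms
  have hj : ∀ j : Fin (n + 1), ∫⁻ X in cellN (n + 1) L,
      periodicInteraction w L X * ((‖Φ (j.removeNth X)‖₊ : ℝ≥0∞)) ^ 2 =
        ENNReal.ofReal L ^ 3 * potForm w L Φ + ((n : ℝ≥0∞) * ∫⁻ z : Space, w ‖z‖) * normSq L Φ := by
    intro j
    rw [lintegral_cellN_symm_mul_removeNth hW hsymm hΦ2 j]
    simp only [lintegral_cell_periodicInteraction_vecCons_eq hL hw, add_mul]
    have hm : Measurable fun Y : Config n =>
        ENNReal.ofReal L ^ 3 * periodicInteraction w L Y * ((‖Φ Y‖₊ : ℝ≥0∞)) ^ 2 :=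
      (hWn.const_mul _).mul hΦ2
    rw [lintegral_add_left hm]
    simp only [mul_assoc]
    rw [lintegral_const_mul' _ _ hV', lintegral_const_mul' (n : ℝ≥0∞) _ (ENNReal.natCast_ne_top n),
      lintegral_const_mul _ hΦ2]
    rfl
  have hG : ∀ j : Fin (n + 1), Measurable fun X : Config (n + 1) =>
      periodicInteraction w L X * ((‖Φ (j.removeNth X)‖₊ : ℝ≥0∞)) ^ 2 := fun j =>
    hW.mul (hΦ2.comp (continuous_removeNth j).measurable)
  calc potForm w L (modeCr (planeWaveMode L k) Φ)
      ≤ ∫⁻ X in cellN (n + 1) L, periodicInteraction w L X *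
          ((ENNReal.ofReal L ^ 3)⁻¹ * ∑ j : Fin (n + 1), ((‖Φ (j.removeNth X)‖₊ : ℝ≥0∞)) ^ 2) :=
        lintegral_mono fun X => mul_le_mul_right (nnnorm_modeCr_sq_le hL k Φ X) _
    _ = (ENNReal.ofReal L ^ 3)⁻¹ * ∑ j : Fin (n + 1), ∫⁻ X in cellN (n + 1) L,
          periodicInteraction w L X * ((‖Φ (j.removeNth X)‖₊ : ℝ≥0∞)) ^ 2 := by
        have h1 : ∀ X : Config (n + 1), periodicInteraction w L X *
            ((ENNReal.ofReal L ^ 3)⁻¹ * ∑ j : Fin (n + 1), ((‖Φ (j.removeNth X)‖₊ : ℝ≥0∞)) ^ 2) =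
            (ENNReal.ofReal L ^ 3)⁻¹ * ∑ j : Fin (n + 1),
              periodicInteraction w L X * ((‖Φ (j.removeNth X)‖₊ : ℝ≥0∞)) ^ 2 := fun X => by
          rw [mul_left_comm, Finset.mul_sum]
        simp only [h1]
        rw [lintegral_const_mul' _ _ (ENNReal.inv_ne_top.2 hV),
          lintegral_finsetSum _ fun j _ => hG j]
    _ = (n + 1 : ℝ≥0∞) * (potForm w L Φ +
          (ENNReal.ofReal L ^ 3)⁻¹ * ((n : ℝ≥0∞) * ∫⁻ z : Space, w ‖z‖) * normSq L Φ) := by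
        simp only [hj, Finset.sum_const, Finset.card_univ, Fintype.card_fin, nsmul_eq_mul]
        push_cast
        rw [mul_left_comm, mul_add, ← mul_assoc, ENNReal.inv_mul_cancel hV hV', one_mul,
          ← mul_assoc]

/-! ## P-d: finiteness of `P[aΦ]`, `P[a†Φ]` -/

/-- P-d (finiteness): `P[aΦ] < ∞` and `P[a†Φ] < ∞` when `P[Φ] < ∞` and `∫w < ∞` (crude bounds B8/B9). -/
theorem potForm_modeAn_ne_top_and (hL : 0 < L) {w : ℝ → ℝ≥0∞} (hw : Measurable w) (hint : (∫⁻ z : Space, w ‖z‖) ≠ ⊤)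
    (k : Fin 3 → ℤ) {Φ : Config (m + 1) → ℂ} (hΦ : IsCore L Φ) (hP : potForm w L Φ ≠ ⊤) :
    potForm w L (modeAn L (planeWaveMode L k) Φ) ≠ ⊤ ∧ potForm w L (modeCr (planeWaveMode L k) Φ) ≠ ⊤ := by
  have hc : Continuous Φ := hΦ.contDiff.continuous
  have hV : ENNReal.ofReal L ^ 3 ≠ 0 := pow_ne_zero _ (ENNReal.ofReal_pos.2 hL).ne'
  refine ⟨ne_top_of_le_ne_top (ENNReal.mul_ne_top (by simp) hP) (potForm_modeAn_le hL hw k hc),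
    ne_top_of_le_ne_top (ENNReal.mul_ne_top (by simp) (ENNReal.add_ne_top.2 ⟨hP, ?_⟩))
      (potForm_modeCr_le hL hw k hc)⟩
  exact ENNReal.mul_ne_top (ENNReal.mul_ne_top (ENNReal.inv_ne_top.2 hV)
    (ENNReal.mul_ne_top (ENNReal.natCast_ne_top _) hint)) (lintegral_cellN_sq_lt_top L hc).ne

end Summit.AtomisticToContinuum.BoseEinsteinCondensation.Cruxes.PeriodicIRBound.LinearPhFloorWagner.WF

end

namespace Summit.AtomisticToContinuum.BoseEinsteinCondensation.Cruxes.PeriodicIRBound.LinearPhFloorWagner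

/-- The registered sub-goal `stub_wfFormBounds` of the crux ledger: this file's headline lemma `WF.potForm_modeAn_ne_top_and`. -/
theorem stub_wfFormBounds : WF.Pkg.FormBounds :=
  @WF.potForm_modeAn_ne_top_and

end Summit.AtomisticToContinuum.BoseEinsteinCondensation.Cruxes.PeriodicIRBound.LinearPhFloorWagner
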